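import Literature.NumberTheory.Rogawski1990.CohomologicalFinComponentIsThetaSigned
import Literature.NumberTheory.Automorphic.Liu2021.CohHolMeetsThetaLiftFromLine
import Literature.NumberTheory.Automorphic.Liu2021.ThetaLiftFromLineFinComponent
import Literature.NumberTheory.Automorphic.Liu2021.ThetaLiftFromLineArchAssembly
import Literature.NumberTheory.Automorphic.Liu2021.ThetaLiftFromLineFrame
import Summits.HodgeConjecture.HodgeConjecture.Theorems.F0P2oCcArchTypeAwayHolds   -- ★ p836451 A-p19 (g19) node Cc: `meetsThetaLiftFromLine_hol_archTypeAway_holds` HYPOTHESIS-FREE ⇒ `stub_Cc_archTypeAway` closed BY NAME («Cc+B FOLD», v4b)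
import Summits.HodgeConjecture.HodgeConjecture.Theorems.F0P2NodeBFinComponentHolds   -- ★ p831362 node B: `meetsThetaLiftFromLine_hasFinComponent_rhoAtLine_holds` HYPOTHESIS-FREE ⇒ `stub_B_finComponent` closed BY NAME (F0P2-ref1 (g5) r212 ①; «Cc+B FOLD», v4b)
import Summits.HodgeConjecture.HodgeConjecture.Theorems.F0P2oCinfArchTypeAtHolds   -- ★ p838562 A-p19 (g20) C∞ closer: `meetsThetaLiftFromLine_hol_archTypeAt_holds` HYPOTHESIS-FREE ⇒ C∞ closed BY NAME («C∞ FOLD», two-site rule s737)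
import HarnessLib

/-!
# Crux `H413`, programme P2, topic T5 = P8 — THE (C♯)hol INTERIOR ALONG [Liu2021, Prop. 4.13 proof Case 1]: letter #87
# `Rogawski1990.cohFinComponent_isThetaSigned_hol` ⟸ D1 (theta exhaustion from `U(1)`) + B (finite local–global) + C∞ ∕ Cc (archimedean Weil
# dictionary, Lem. D.2 (2) ∕ (1) per place; the CM-type arithmetic C∞ → Cc → C is ★ PROVED) + the in-house frame ∕ compactness supply (`cSharpHol_of_T5`)
# — sub-line T5a `F0_P2CSharpHolThetaLine` (head = `stub_CSharp_letter` of `Lines/F0_P2E3Rung3.lean` BY NAME), EDITION v4b «Cc+B FOLD» (desk F0P2-plan (g9), 2026-09-01, over typ-T5a (g0)՚s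
# draft v3 4ea5960857b150b3; F0P2-ref1 (g5) r212 ①: B folded too) → EDITION v5 «C∞ FOLD» (desk F0P2-plan (g9), 2026-09-01; ★ p838562 A-p19 (g20); two-site rule s737 with `Lines/F0_P2E3Rung3.lean` v1.4): 1 open stub {D1}, a Literature statement BY NAME; C∞ ★ CLOSED BY NAME over p838562, Cc ★ over p836451, B ★ over p831362; the in-house supply F is the tree theorem ★ `Liu2021.adelicFrameCompact`)

Cell hodgecm-mathlib (D-0151), FLOOR 0, crux item H413 = stmt-HodgeConjecture-24833, route of record `HCCMUnconditional`; programme P2, socket 27455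
`F0HdictE` (MINIMAL ROAD, s552: ★ p823508 + ★ p825500∕p825579 ⇒ `F0HdictE` holds modulo the ONE printed letter (C♯)hol = `stub_CSharp_letter` of
`Lines/F0_P2E3Rung3.lean` v1.2, books row III-33 (#87)).  Typer∕survey seat hodgecm-mathlib-typ-T5a (g0), 2026-08-31 (director g16 PLAN-THROUGHPUT-P2-P5
§4 row T5: «(C♯)hol interior — D2 typer … then D1 survey»; draft v1–v3 in HOME `F0/P2/Lines-draft/`); registration candidate prepared by the desk F0P2-plan (g9) — written to
`Cruxes/H413/Lines/F0_P2CSharpHolThetaLine.lean` ONLY on director g18՚s word (s609 «first desk block»; s729 (4)); registered BY WRITE, no `skeleton check` (registry of record for 24833 = `a3_liu413`).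
HC_CM is proved only modulo the printed citations until rung 0 closes.  This file discharges none of them: it CUTS letter #87 into four printed statements
(LETTER A = D1, PAYABLE node B, LETTER C∞ = Lem. D.2 (2) at `ι`, PAYABLE node Cc = Lem. D.2 (1) off `ι` — all typed as Literature named facts over ONE new
seam predicate ★ `Liu2021.MeetsThetaLiftFromLine`) and proves the composition; the CM-type arithmetic «By Lemma D.2, μ is of weight one and ε_e is μ-admissible» is the tree THEOREM
★ `Liu2021.hasWeightOne_admissible_of_archTypes` (v1's stub D2 = node C ★ p826167 is thereby retired to C∞ + Cc), and v2's in-house supply stub F (adelic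
frame transport + compactness of `[U(diag dV)]`) is the tree THEOREM ★ `Liu2021.adelicFrameCompact`.

## Edition v5 «C∞ FOLD» (desk F0P2-plan (g9), 2026-09-01; closer ★ p838562 `Theorems/F0P2oCinfArchTypeAtHolds.lean :: meetsThetaLiftFromLine_hol_archTypeAt_holds` — A-p19 (g20), HYPOTHESIS-FREE, TRIO, over the
C∞ chain FILE 1 p837637 · (W1) p837953 · (W2) p838134 · (P2) p838128 · (P3) p838296 · (WT) p838377; F0P2-ref1 (g5) r220 box + v5 probe a7d91eb74eb7ebac; written in the SAME kick window as `Lines/F0_P2E3Rung3.lean` v1.4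
«C∞ FOLD» — director s737 two-site rule).  CHANGED-BODY-ONLY exactly {`stub_Cinf_archTypeAt := F0P2oCinfArchTypeAtHolds.meetsThetaLiftFromLine_hol_archTypeAt_holds`} (statement = the Literature named fact BY NAME,
unchanged), + its import; every other decl byte-unchanged vs v4b f410f6303263562d.  Sorry set after v5: {`stub_D1_thetaExhaustion`} = letter D1 (#113) ALONE — the (C♯)hol path to socket 27455 now rests on ONE
printed statement, theta exhaustion from `U(1)`.  Books: #114 C∞ CLOSED-PROVED (p838562) once no registered file carries it by `sorry` (this write + E3Rung3 v1.4).  HC_CM is proved only modulo the printed citations until rung 0 closes.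

## Idea (the printed proof, [Liu2021, FJcycle.tex l. 2129–2141, Camb. J. Math. 9 (2021) pp. 47–48])
«`π` contributes to `H¹` (holomorphic) ⟹ (pole of `L^S(s, π×μ)` at `s₀ = n/2`, Thm. B.4, Cor. B.5, Cor. B.6 (1)) `V_π = Θ^V_{(μ⁻¹,ν⁻¹),−W}(π_W)` for a
one-dimensional skew-hermitian `W` [D1 = letter A] ⟹ «in other words `π^∞ ≃ ω(μ, ε_e, χ)`» [B] and `π_{∞1} ≃ ω^{m₁,±}_{n−1,1}`, `π_{∞i} ≃ ω^{m_i,±}_{n,0}`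
⟹ (Lem. D.2) `μ` of weight one and `ε_e` `μ`-admissible [D2 = letter C].»  The SEAM OBJECT is ★ `MeetsThetaLiftFromLine L 3 H e₁ dV hdV hdV0 P μ hμ a ιA`
(«`P` contains a non-zero global theta vector from the line `⟨a⟩` at the `μ`-attached splitting ★ `chiSplittingLine`», the same splitting (C♯)hol's
carrier `rhoAtLine … a χ` is built on).  The fourth stub supplies, in house, the adelic frame transport `ιA = (k ↦ g_𝔸⁻¹ k g_𝔸)` and the compactness of
`[U(diag dV)]` (anisotropy: `H` is definite at a place since `[L⁺:ℚ] ≥ 2`; ★ `AnisotropicUnitaryGroupCompactOfPlace`, ★ `cmFrameEquiv`).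

## Registered stubs (4: D1 open — C∞ ★ closed by name at v5; B, Cc at v4b) and head
| stub | Lean | class ∕ size | why this line |
|---|---|---|---|
| D1 | `stub_D1_thetaExhaustion : Liu2021.cohHol_meetsThetaLiftFromLine` | LETTER (XL as a proof: pole of `L^S(s,π×μ)` [BMM 13.4 pf], [Liu2021 Thm. B.4∕Cor. B.5∕Cor. B.6], [Wu2013]; `n = 3`: [Rogawski1990 13.3.6 (c)] + [GR91 Thm. 5.1.1]) | the only global input; isolates everything Arthur∕Rogawski-dependent in ONE statement whose conclusion is a concrete vector in `P` |
| B ★ | `stub_B_finComponent : Liu2021.meetsThetaLiftFromLine_hasFinComponent_rhoAtLine := …F0P2NodeBFinComponentHolds.meetsThetaLiftFromLine_hasFinComponent_rhoAtLine_holds` (v4b: ★ CLOSED BY NAME, p831362, HYPOTHESIS-FREE) | was PAYABLE-NOW modulo booked letters, L (character resolution ★ `…ThetaLiftCharacterSpan`, covariance ★ `…ThetaLiftCharacterCovariance`, `𝒮 = 𝒮_∞ ⊗ 𝒮_f` ★ `SchwartzPairingFactorisation`, irreducibility [Liu2021 Lem. D.1] ★) | the junction of the theta-kernel datum with the Weil-carrier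 lane — in-house mathematics, no new print |
| C∞ ★ | `stub_Cinf_archTypeAt : Liu2021.meetsThetaLiftFromLine_hol_archTypeAt := …F0P2oCinfArchTypeAtHolds.meetsThetaLiftFromLine_hol_archTypeAt_holds` (v5: ★ CLOSED BY NAME, p838562 A-p19 (g20), HYPOTHESIS-FREE) | was LETTER #114; IN-HOUSE ROAD DELIVERED (A-p19 (g20), desk «= GO» 23:23:03Z: FILE 1 ★ p837637 `Liu2021/ThetaLiftFromLineEquivariantFunctional` → (W1) p837953 → (W2) `…ArchPlaceVacuumBlock` → (P2)(P3)∕(F1)(F2) → (C) `Theorems/F0P2oCinfArchTypeAtHolds.lean :: meetsThetaLiftFromLine_hol_archTypeAt_holds` = the v5 «C∞ FOLD» token) (M–L: [Liu2021 Lem. D.2 (2)] ⟸ [KK07 Thm. 5.4] + [BMM §5.7]; pay-down needs a `(𝔤,K)`-module on the ★ `IsArchWeilDatum` Schwartz model of `U(2,1) × U(1)` — junction ABSENT) | the irreducible archimedean content: which oscillator `(𝔤,K)`-module of `U(2,1)` carries the holomorphic class |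
| Cc ★ | `stub_Cc_archTypeAway : Liu2021.meetsThetaLiftFromLine_hol_archTypeAway := …F0P2oCcArchTypeAwayHolds.meetsThetaLiftFromLine_hol_archTypeAway_holds` (v4b: ★ CLOSED BY NAME, p836451 A-p19 (g19), HYPOTHESIS-FREE) | was PAYABLE-NOW, M ([Liu2021 Lem. D.2 (1)]: vacuum character of the COMPACT pair `U(3,0) × U(1)`, ★ `KashiwaraVergne1978.*`, ★ `Adams2007.VacuumWeight`, ★ `KonnoKonno2007.JunctionVacuumDefinite`) | the definite places contribute only the vacuum character — a finite check |
Head: `cSharpHol_of_stubs : D1 → B → C∞ → Cc → Rogawski1990.cohFinComponent_isThetaSigned_hol` (node C by ★ `hasWeightOne_admissible_of_archTypes`, the frame by ★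
`adelicFrameCompact`, then `obtain` ×4 + `exact`), concluder `cSharpHol_of_T5`.

## References
- [Liu2021] Y. Liu, *Fourier–Jacobi cycles and arithmetic relative trace formula*, Camb. J. Math. 9 (2021): Prop. 4.13 pp. 47–49 (proof Case 1 l. 2129–2141), Rem. 4.14,
  App. B Thm. B.4 ∕ Cor. B.5 p. 98, Cor. B.6 p. 99, App. D §D.1 Lem. D.2 p. 127, Def. 4.11 p. 46, Def. 4.12 p. 47.
- [BergeronMillsonMoeglin2016Balls] Acta Math. 216 (2016), Thm. 7.2 p. 65, Prop. 13.4, §5.7.  [KonnoKonno2007] Kyushu J. Math. 61 (2007), Thm. 5.4.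
- [Rogawski1990] Ann. of Math. Stud. 123, Thm. 13.3.6 (c) p. 201, §15.3.  [GelbartRogawski1991] Invent. Math. 105, Thm. 5.1.1 p. 465, §3.2 p. 457.
- [Rallis1984] Compositio Math. 51, Thm. 1.2.2 (proof p. 356).  [Weil1964] Acta Math. 111, n° 41.
-/

set_option autoImplicit false
set_option linter.dupNamespace false

noncomputable section

open NumberField NumberField.InfinitePlace IsDedekindDomain MeasureTheory
open scoped Matrix ComplexOrder

open Literature.NumberTheory Literature.NumberTheory.Automorphic Literature.NumberTheory.Automorphic.UnitaryGroup
open Literature.NumberTheory.Automorphic.UnitaryGroup.CotangentForms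
open Literature.NumberTheory.Automorphic.IdeleClassGroup
open Literature.NumberTheory.Automorphic.Liu2021
open Literature.NumberTheory.Rogawski1990

namespace Summit.HodgeConjecture.HodgeConjecture.Cruxes.H413.F0P2CSharpHolThetaLine

/-! ## §1 Registered stubs (D1 open; C∞, B, Cc ★ closed by name — Literature named facts BY NAME) -/

/-- D1, registered (LETTER A). -/
theorem stub_D1_thetaExhaustion : Literature.NumberTheory.Automorphic.Liu2021.cohHol_meetsThetaLiftFromLine := by
  sorry

/-- **B — ★ CLOSED BY NAME, HYPOTHESIS-FREE** (edition v4b «Cc+B FOLD» over ★ p831362 `F0P2NodeBFinComponentHolds.meetsThetaLiftFromLine_hasFinComponent_rhoAtLine_holds` (18:52Z 2026-08-31; F0P2-ref1 (g5) r212 ①):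
statement = the Literature named fact BY NAME, unchanged; no `sorry`). -/
theorem stub_B_finComponent : Literature.NumberTheory.Automorphic.Liu2021.meetsThetaLiftFromLine_hasFinComponent_rhoAtLine :=
  Summit.HodgeConjecture.HodgeConjecture.Cruxes.H413.F0P2NodeBFinComponentHolds.meetsThetaLiftFromLine_hasFinComponent_rhoAtLine_holds

/-- **C∞ — ★ CLOSED BY NAME, HYPOTHESIS-FREE** (edition v5 «C∞ FOLD» over ★ p838562 A-p19 (g20) `F0P2oCinfArchTypeAtHolds.meetsThetaLiftFromLine_hol_archTypeAt_holds`: Lem. D.2 (2) at `ι` — the `(𝔤,K)`-type of the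
holomorphic theta vector read off the Fock–Hermite torus covariance; statement = the Literature named fact BY NAME, unchanged; no `sorry`). [cite: Liu2021, Lem. D.2 (2) p. 127] -/
theorem stub_Cinf_archTypeAt : Literature.NumberTheory.Automorphic.Liu2021.meetsThetaLiftFromLine_hol_archTypeAt :=
  Summit.HodgeConjecture.HodgeConjecture.Cruxes.H413.F0P2oCinfArchTypeAtHolds.meetsThetaLiftFromLine_hol_archTypeAt_holds

/-- **Cc — ★ CLOSED BY NAME, HYPOTHESIS-FREE** (edition v4b «Cc+B FOLD» over ★ p836451 A-p19 (g19) `F0P2oCcArchTypeAwayHolds.meetsThetaLiftFromLine_hol_archTypeAway_holds`: Lem. D.2 (1) off `ι` —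
the definite places contribute only the vacuum character; statement = the Literature named fact BY NAME, unchanged; no `sorry`). [cite: Liu2021, Lem. D.2 (1) p. 127] -/
theorem stub_Cc_archTypeAway : Literature.NumberTheory.Automorphic.Liu2021.meetsThetaLiftFromLine_hol_archTypeAway :=
  Summit.HodgeConjecture.HodgeConjecture.Cruxes.H413.F0P2oCcArchTypeAwayHolds.meetsThetaLiftFromLine_hol_archTypeAway_holds

/-! ## §2 Composition (sorry-free): D1 → B → C∞ → Cc → letter #87 -/

set_option synthInstance.maxHeartbeats 400000 in
set_option maxHeartbeats 8000000 in
/-- **THE COMPOSITION**: theta exhaustion (D1), the finite local–global node (B), the two applied clauses of the archimedean Weil dictionary (C∞, Cc; node C by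
the tree theorem ★ `hasWeightOne_admissible_of_archTypes`) and the frame∕compactness supply (★ `adelicFrameCompact`) give print letter #87 (C♯)hol verbatim.
[cite: Liu2021, Prop. 4.13 proof Case 1 (l. 2129–2141, pp. 47–48); Lem. D.2 p. 127] -/
theorem cSharpHol_of_stubs (hA : Literature.NumberTheory.Automorphic.Liu2021.cohHol_meetsThetaLiftFromLine)
    (hB : Literature.NumberTheory.Automorphic.Liu2021.meetsThetaLiftFromLine_hasFinComponent_rhoAtLine)
    (hCi : Literature.NumberTheory.Automorphic.Liu2021.meetsThetaLiftFromLine_hol_archTypeAt)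
    (hCc : Literature.NumberTheory.Automorphic.Liu2021.meetsThetaLiftFromLine_hol_archTypeAway) :
    Literature.NumberTheory.Rogawski1990.cohFinComponent_isThetaSigned_hol := by
  have hF := Literature.NumberTheory.Automorphic.Liu2021.adelicFrameCompact
  have hC : Literature.NumberTheory.Automorphic.Liu2021.meetsThetaLiftFromLine_hol_hasWeightOne_admissible :=
    Literature.NumberTheory.Automorphic.Liu2021.hasWeightOne_admissible_of_archTypes hCi hCc
  intro L _ _ _ ι H T hT hdef hd n' e₁ dV hdV hdV0 g hg ιV hιV μA _ P hP
  obtain ⟨ιA, hιA, hcpt⟩ := hF L ι H hdef hd dV hdV hdV0 g hg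
  haveI := hcpt
  obtain ⟨μ, hμ, a, hmeet⟩ := hA L ι H T hT hdef hd e₁ dV hdV hdV0 g hg ιA hιA μA P hP
  obtain ⟨χ, hfin⟩ := hB L ι H T hT hdef hd e₁ dV hdV hdV0 g hg ιV hιV ιA hιA μA P μ hμ a hmeet hP
  obtain ⟨hw, hadm⟩ := hC L ι H T hT hdef hd e₁ dV hdV hdV0 g hg ιA hιA μA P μ hμ a hmeet hP
  exact ⟨μ, hμ, hw, a, χ, hadm, hfin⟩

/-- **THE CONCLUDER** (by name, the consumer's shape `stub_CSharp_letter` of `Lines/F0_P2E3Rung3.lean` v1.2). -/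
theorem cSharpHol_of_T5 : Literature.NumberTheory.Rogawski1990.cohFinComponent_isThetaSigned_hol :=
  cSharpHol_of_stubs stub_D1_thetaExhaustion stub_B_finComponent stub_Cinf_archTypeAt stub_Cc_archTypeAway

end Summit.HodgeConjecture.HodgeConjecture.Cruxes.H413.F0P2CSharpHolThetaLine

end
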